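import Literature.NumberTheory.EllipticCurves.KubertTwoTenProofs
import Mathlib.NumberTheory.Real.Irrational
import HarnessLib

/-!
# Crux `MazurKenkuBound` (stmt-ABC-15125), line `radius-lite` — Kenku's level `20`, step 2:
# the fibre product `X₀(4) ×_{X(1)} X₀(5)` has no rational point off the cusps

THE DIOPHANTINE END of the modular-curve-free treatment of Kenku's level `20` (registered stub
`stub_levelTwentyNoPoint`): there are no `s, t ∈ ℚ` with `t ≠ 0`, `s² ≠ 4` and
`256 t (s² − 3)³ = (s² − 4)(t² + 10t + 5)³` (equality of the `j`-maps of `X₀(4)`,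
`s ↦ 256(s² − 3)³/(s² − 4)`, and of `X₀(5)`, Klein–Fricke `t ↦ (t² + 10t + 5)³/t`).

Proof (explicit, kernel-checked algebra; derivation `work/level20/*.py` of the lead, attached as
evidence): the genus-`0` quotient `X₀(10)` of the fibre product by `s ↦ -s` has the rational
parameter `β` with `t = (4β + 1)²(β − 1)/β`, `s² = u = 4(4β² + 1)(4β² − 2β − 1)²/(4β + 1)`
(a Belyĭ pair: `t` and `u − 4 = 256β⁵(β − 1)/(4β + 1)` are supported on the four cusps
`β ∈ {0, 1, -1/4, ∞}`), and conversely `β = N(u, t)/D(u, t)` with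
`D = 4(u − 3)(t² + 4t − 1)(t² + 10t + 5)` — nonzero at rational points (`√3, √5 ∉ ℚ`; these are
the singular fibres `j = 0, 1728`) — and `N` of bidegree `(2, 4)`; the two displayed relations are
polynomial identities modulo the curve equation with explicit cofactors (`linear_combination`).
Then `x = 4β`, `y = s(4β + 1)/(4β² − 2β − 1)` satisfy `y² = x³ + x² + 4x + 4` — the curve `20a1`,
a model of `X₀(20)` — whose rational points have `x ∈ {-1, 0, 4}` (`twentyA1_points`: the
`2`-isogeny to `y² = x³ + x² − x` and Kubert's determination of that curve's rational points, tree
theorem `X1TwoTen_points`); each of `β ∈ {-1/4, 0, 1}` contradicts `t ≠ 0` or the relations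
(`β = 0, 1, -1/4` are cusps).

## References

* [Kenku1982] M. A. Kenku, J. Number Theory 15 (1982) 199–202, proof of Thm. 1 (level `20`).
* [Ligozat1975] G. Ligozat, *Courbes modulaires de genre 1*, Mém. SMF 43 (1975) (`X₀(20)`).
* [Kubert1976] D. S. Kubert, Proc. London Math. Soc. (3) 33 (1976) 193–237, Ch. IV.
* [CremonaAlgorithms1997] J. E. Cremona, *Algorithms for Modular Elliptic Curves*, Table 1, `20A`.
-/

-- `Summit.ABC.ABC` is the mandated summit-side namespace (CONVENTIONS §2); the duplicate is deliberate.
set_option linter.dupNamespace false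

noncomputable section

open Literature.NumberTheory.EllipticCurves

namespace Summit.ABC.ABC.Theorems

/-! ### Small irrationalities -/

/-- A rational square is not a prime. [folklore] -/
private theorem sq_ne_prime {p : ℕ} (hp : p.Prime) (q : ℚ) : q ^ 2 ≠ p := by
  intro h
  refine hp.irrational_sqrt ⟨|q|, ?_⟩
  have hq : ((|q| : ℚ) : ℝ) ^ 2 = (p : ℝ) := by
    rw [Rat.cast_abs, sq_abs, ← Rat.cast_pow, h, Rat.cast_natCast]
  rw [← Real.sqrt_sq (by positivity : (0 : ℝ) ≤ ((|q| : ℚ) : ℝ)), hq]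

/-- `3` is not a rational square. [folklore] -/
theorem rat_sq_ne_three (q : ℚ) : q ^ 2 ≠ 3 := by exact_mod_cast sq_ne_prime Nat.prime_three q

/-- `5` is not a rational square. [folklore] -/
theorem rat_sq_ne_five (q : ℚ) : q ^ 2 ≠ 5 := by
  exact_mod_cast sq_ne_prime Nat.prime_five q

/-! ### The rational points of `20a1` -/

/-- **The rational points of `y² = x³ + x² + 4x + 4` have `x ∈ {-1, 0, 4}`** (the curve `20a1`,
a model of `X₀(20)`; via the `2`-isogeny to `y² = x³ + x² − x` and Kubert's determination of the
latter's rational points, tree theorem `X1TwoTen_points`). [cite: Kubert1976, Ch. IV]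
[cite: SilvermanAEC2009, III.4 Example 4.5] -/
theorem twentyA1_points (x y : ℚ) (h : y ^ 2 = x ^ 3 + x ^ 2 + 4 * x + 4) :
    x = -1 ∨ x = 0 ∨ x = 4 := by
  by_cases hx : x + 1 = 0
  · exact Or.inl (by linarith)
  -- `y² = x₁(x₁² - 2x₁ + 5)` with `x₁ = x + 1 ≠ 0`
  have h₁ : y ^ 2 = (x + 1) * ((x + 1) ^ 2 - 2 * (x + 1) + 5) := by linear_combination h
  -- the `2`-isogenous point `(x', y')` on `y'² = x'³ + x'² - x'`
  have h' : (y * ((x + 1) ^ 2 - 5) / (8 * (x + 1) ^ 2)) ^ 2 =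
      (((x + 1) ^ 2 - 2 * (x + 1) + 5) / (4 * (x + 1))) ^ 3 +
        (((x + 1) ^ 2 - 2 * (x + 1) + 5) / (4 * (x + 1))) ^ 2 -
        ((x + 1) ^ 2 - 2 * (x + 1) + 5) / (4 * (x + 1)) := by
    rw [div_pow, mul_pow, h₁]
    field_simp
    ring
  rcases X1TwoTen_points _ _ h' with h0 | h1 | hm1
  · -- `x' = 0`: `x₁² - 2x₁ + 5 = 0`, impossible
    rw [div_eq_zero_iff] at h0
    rcases h0 with h0 | h0
    · nlinarith [sq_nonneg x]
    · exact absurd (by linarith : x + 1 = 0) hx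
  · -- `x' = 1`: `x₁² - 6x₁ + 5 = 0`, so `x₁ ∈ {1, 5}`
    rw [div_eq_one_iff_eq (by positivity)] at h1
    have : x * (x - 4) = 0 := by linear_combination h1
    rcases mul_eq_zero.mp this with h | h
    · exact Or.inr (Or.inl h)
    · exact Or.inr (Or.inr (by linarith))
  · -- `x' = -1`: `x₁² + 2x₁ + 5 = 0`, impossible
    rw [div_eq_iff (by positivity), neg_one_mul] at hm1
    nlinarith [sq_nonneg (x + 2)]


/-! ### The Diophantine end -/

/-- Certificate 1 (the cubic relation `tβ = (4β + 1)²(β − 1)` for `β = N/D`, cleared of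
denominators): a polynomial identity modulo the curve equation, cofactor of 26 terms. [folklore] -/
private theorem level20_cert_cubic {u t N D : ℚ}
    (hN : N =
    (16 : ℚ) * u ^ 2 * t ^ 2 + (48 : ℚ) * u ^ 2 * t + (1 : ℚ) * u * t ^ 4 + (16 : ℚ) * u * t ^ 3
    + (-30 : ℚ) * u * t ^ 2 + (-248 : ℚ) * u * t + (5 : ℚ) * u + (-4 : ℚ) * t ^ 4
    + (-68 : ℚ) * t ^ 3 + (-164 : ℚ) * t ^ 2 + (212 : ℚ) * t + (-40 : ℚ))
    (hD : D =
    (4 : ℚ) * u * t ^ 4 + (56 : ℚ) * u * t ^ 3 + (176 : ℚ) * u * t ^ 2 + (40 : ℚ) * u * t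
    + (-20 : ℚ) * u + (-12 : ℚ) * t ^ 4 + (-168 : ℚ) * t ^ 3 + (-528 : ℚ) * t ^ 2
    + (-120 : ℚ) * t + (60 : ℚ))
    (hP : 256 * t * (u - 3) ^ 3 = (u - 4) * (t ^ 2 + 10 * t + 5) ^ 3) :
    t * N * D ^ 2 = (4 * N + D) ^ 2 * (N - D) := by
  subst hN hD
  linear_combination (
    (-256 : ℚ) * u ^ 3 * t ^ 5 + (-2304 : ℚ) * u ^ 3 * t ^ 4 + (-6912 : ℚ) * u ^ 3 * t ^ 3 + (-6912 : ℚ) * u ^ 3 * t ^ 2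
    + (-16 : ℚ) * u ^ 2 * t ^ 7 + (-416 : ℚ) * u ^ 2 * t ^ 6 + (-1520 : ℚ) * u ^ 2 * t ^ 5 + (5696 : ℚ) * u ^ 2 * t ^ 4
    + (36368 : ℚ) * u ^ 2 * t ^ 3 + (45408 : ℚ) * u ^ 2 * t ^ 2 + (-3600 : ℚ) * u ^ 2 * t + (96 : ℚ) * u * t ^ 7
    + (2496 : ℚ) * u * t ^ 6 + (16032 : ℚ) * u * t ^ 5 + (28032 : ℚ) * u * t ^ 4 + (-31584 : ℚ) * u * t ^ 3
    + (-85824 : ℚ) * u * t ^ 2 + (21600 : ℚ) * u * t + (-144 : ℚ) * t ^ 7 + (-3728 : ℚ) * t ^ 6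
    + (-27024 : ℚ) * t ^ 5 + (-68112 : ℚ) * t ^ 4 + (-25136 : ℚ) * t ^ 3 + (60624 : ℚ) * t ^ 2
    + (-20400 : ℚ) * t + (2000 : ℚ)) * hP

/-- Certificate 2 (the reduced relation `u(4β + 1) = (t² + 10t + 5)β² + 12β + 3` for `β = N/D`,
cleared of denominators): a polynomial identity modulo the curve equation, cofactor of 10 terms.
[folklore] -/
private theorem level20_cert_reduced {u t N D : ℚ}
    (hN : N =
    (16 : ℚ) * u ^ 2 * t ^ 2 + (48 : ℚ) * u ^ 2 * t + (1 : ℚ) * u * t ^ 4 + (16 : ℚ) * u * t ^ 3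
    + (-30 : ℚ) * u * t ^ 2 + (-248 : ℚ) * u * t + (5 : ℚ) * u + (-4 : ℚ) * t ^ 4
    + (-68 : ℚ) * t ^ 3 + (-164 : ℚ) * t ^ 2 + (212 : ℚ) * t + (-40 : ℚ))
    (hD : D =
    (4 : ℚ) * u * t ^ 4 + (56 : ℚ) * u * t ^ 3 + (176 : ℚ) * u * t ^ 2 + (40 : ℚ) * u * t
    + (-20 : ℚ) * u + (-12 : ℚ) * t ^ 4 + (-168 : ℚ) * t ^ 3 + (-528 : ℚ) * t ^ 2
    + (-120 : ℚ) * t + (60 : ℚ))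
    (hP : 256 * t * (u - 3) ^ 3 = (u - 4) * (t ^ 2 + 10 * t + 5) ^ 3) :
    u * (4 * N + D) * D = (t ^ 2 + 10 * t + 5) * N ^ 2 + 12 * N * D + 3 * D ^ 2 := by
  subst hN hD
  linear_combination (
    (1 : ℚ) * u * t ^ 4 + (12 : ℚ) * u * t ^ 3 + (22 : ℚ) * u * t ^ 2 + (-20 : ℚ) * u * t
    + (-15 : ℚ) * u + (-4 : ℚ) * t ^ 4 + (-56 : ℚ) * t ^ 3 + (-176 : ℚ) * t ^ 2
    + (-40 : ℚ) * t + (20 : ℚ)) * hP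

/-- The endgame on the curve `20a1`: rational `s, t, β` with `t ≠ 0`, `tβ = (4β + 1)²(β − 1)` and
`s²(4β + 1) = (t² + 10t + 5)β² + 12β + 3` do not exist — the two relations give
`s²(4β + 1) = 4(4β² + 1)(4β² − 2β − 1)²`, so `(4β, s(4β + 1)/(4β² − 2β − 1))` is a rational point
of `y² = x³ + x² + 4x + 4`, and `twentyA1_points` leaves `β ∈ {-1/4, 0, 1}`, the cusps, each
incompatible with the relations and `t ≠ 0`. [cite: Kubert1976, Ch. IV] -/
theorem level20_endgame {s t β : ℚ} (ht : t ≠ 0) (hT : t * β = (4 * β + 1) ^ 2 * (β - 1))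
    (hU : s ^ 2 * (4 * β + 1) = (t ^ 2 + 10 * t + 5) * β ^ 2 + 12 * β + 3) : False := by
  -- the cubic relation lifts the reduced relation to the curve equation
  have hC : 16 * β ^ 3 - 8 * β ^ 2 - (7 + t) * β - 1 = 0 := by linear_combination -hT
  have hU' : s ^ 2 * (4 * β + 1) = 4 * (4 * β ^ 2 + 1) * (4 * β ^ 2 - 2 * β - 1) ^ 2 := by
    linear_combination hU - (16 * β ^ 3 - 8 * β ^ 2 + β * t + 3 * β - 1) * hC
  have hq : 4 * β ^ 2 - 2 * β - 1 ≠ 0 := fun h ↦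
    rat_sq_ne_five (4 * β - 1) (by linear_combination 4 * h)
  have h41 : 4 * β + 1 ≠ 0 := by
    intro h
    rw [h, mul_zero] at hU'
    have h0 : (4 * β ^ 2 + 1) * (4 * β ^ 2 - 2 * β - 1) ^ 2 = 0 := by linear_combination -hU' / 4
    rcases mul_eq_zero.mp h0 with h1 | h2
    · exact absurd h1 (by positivity)
    · exact hq (pow_eq_zero_iff two_ne_zero |>.mp h2)
  have hE : (s * (4 * β + 1) / (4 * β ^ 2 - 2 * β - 1)) ^ 2 =
      (4 * β) ^ 3 + (4 * β) ^ 2 + 4 * (4 * β) + 4 := by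
    rw [div_pow, div_eq_iff (pow_ne_zero 2 hq), mul_pow]
    linear_combination (4 * β + 1) * hU'
  rcases twentyA1_points _ _ hE with h | h | h
  · exact h41 (by linear_combination h)
  · have hb : β = 0 := by linear_combination h / 4
    rw [hb] at hT
    norm_num at hT
  · have hb : β = 1 := by linear_combination h / 4
    rw [hb] at hT
    norm_num at hT
    exact ht hT

/-- **STUB `stub_levelTwentyNoPoint`** (Kenku's level `20`, Diophantine end): no rational `s, t`
with `t ≠ 0`, `s² ≠ 4`, `256 t (s² − 3)³ = (s² − 4)(t² + 10t + 5)³` — i.e. the fibre product of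
the `j`-maps of `X₀(4)` and `X₀(5)` (`≃ X₀(20)`) has no rational point off the cusps. With
`u = s²`: `β = N(u,t)/D(u,t)`, `D = 4(u − 3)(t² + 4t − 1)(t² + 10t + 5) ≠ 0` (`√3, √5 ∉ ℚ`), the
two certificates, and `level20_endgame`. (`s² ≠ 4` is not even needed: `s = ±2` forces `t = 0`.)
[cite: Kenku1982, proof of Thm. 1, level 20] [cite: Ligozat1975] -/
theorem stub_levelTwentyNoPoint :
    ∀ s t : ℚ, t ≠ 0 → s ^ 2 ≠ 4 →
      256 * t * (s ^ 2 - 3) ^ 3 = (s ^ 2 - 4) * (t ^ 2 + 10 * t + 5) ^ 3 → False := by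
  intro s t ht _ hP
  set u := s ^ 2 with hu
  -- the harmless denominator `D = 4(u − 3)(t² + 4t − 1)(t² + 10t + 5) ≠ 0`
  have h3 : u - 3 ≠ 0 := fun h ↦ rat_sq_ne_three s (by rw [← hu]; linear_combination h)
  have hq1 : t ^ 2 + 4 * t - 1 ≠ 0 := fun h ↦ rat_sq_ne_five (t + 2) (by linear_combination h)
  have hq2 : t ^ 2 + 10 * t + 5 ≠ 0 := fun h ↦
    rat_sq_ne_five ((t + 5) / 2) (by linear_combination h / 4)
  set N : ℚ :=
    (16 : ℚ) * u ^ 2 * t ^ 2 + (48 : ℚ) * u ^ 2 * t + (1 : ℚ) * u * t ^ 4 + (16 : ℚ) * u * t ^ 3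
    + (-30 : ℚ) * u * t ^ 2 + (-248 : ℚ) * u * t + (5 : ℚ) * u + (-4 : ℚ) * t ^ 4
    + (-68 : ℚ) * t ^ 3 + (-164 : ℚ) * t ^ 2 + (212 : ℚ) * t + (-40 : ℚ) with hN
  set D : ℚ :=
    (4 : ℚ) * u * t ^ 4 + (56 : ℚ) * u * t ^ 3 + (176 : ℚ) * u * t ^ 2 + (40 : ℚ) * u * t
    + (-20 : ℚ) * u + (-12 : ℚ) * t ^ 4 + (-168 : ℚ) * t ^ 3 + (-528 : ℚ) * t ^ 2
    + (-120 : ℚ) * t + (60 : ℚ) with hD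
  have hD0 : D ≠ 0 := by
    have e : D = 4 * (u - 3) * (t ^ 2 + 4 * t - 1) * (t ^ 2 + 10 * t + 5) := by rw [hD]; ring
    rw [e]
    exact mul_ne_zero (mul_ne_zero (mul_ne_zero four_ne_zero h3) hq1) hq2
  have hT := level20_cert_cubic hN hD hP
  have hU := level20_cert_reduced hN hD hP
  clear_value N D
  -- pass to `β = N/D`
  obtain ⟨β, rfl⟩ : ∃ β, N = β * D := ⟨N / D, by field_simp⟩
  have hT' : t * β = (4 * β + 1) ^ 2 * (β - 1) := by
    apply mul_left_cancel₀ (pow_ne_zero 3 hD0)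
    linear_combination hT
  have hU' : u * (4 * β + 1) = (t ^ 2 + 10 * t + 5) * β ^ 2 + 12 * β + 3 := by
    apply mul_left_cancel₀ (pow_ne_zero 2 hD0)
    linear_combination hU
  exact level20_endgame ht hT' (hu ▸ hU')

end Summit.ABC.ABC.Theorems

end
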